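import Literature.Computability.Cryptography.RegevSamplerSubst
import Literature.Computability.Cryptography.RegevCVPOracleTail
import Literature.Algebra.EuclideanLattices.RegevQuantumPartLawNear
import HarnessLib

/-!
# Regev 2009, Lemma 3.14 in machine form: the measured law of the sampler with the `CVP` family `R` in its oracle slots

Topic `Computability/Cryptography` (family `pqc`), grouping namespace `Regev2009.SamplerSubst`; sequel of
`RegevSamplerSubst.lean` (the placement `subE` of the tidy block of a subroutine in the two oracle slots
of the classical stage `stageMat`, `l2Norm_stageMat_sum_sub_le`), `RegevCVPOracleWeighted.lean`
(`CVPOracle.sum_mul_errFn_le_weightedFail_add`: the Gaussian average of the tidy-block error of the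
`CVP` family `R` is at most its weighted failure plus the inadmissible mass, `CVPOracle.dataLaw`) and
`Algebra/EuclideanLattices/RegevQuantumPartLawNear.lean` (`QPart.law_bound_of_basis_near`: Regev's
Lemma 3.14 law bound for a machine whose classical stage is `ε_S`-close to the ideal one on the box
Gaussian). O. Regev, J. ACM 56 (2009), art. 34 (author's version arXiv:2401.03703), proof of Lemma 3.3
with Lemma 3.14 (p. 15, p. 20): the sampler of Lemma 3.14 is run with the `CVP` procedure `R` of
Lemma 3.4 answering its two oracle calls. This file assembles the tree's theorems into the law of THAT
machine — the mathematical content of the bound stated by A_q14 (`regev2009_lemma_3_14_stepFamily`: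
total variation `≤ C·√(weightedFail) + ν'`):

* `sum_boxWeight_eq_one` — the Gaussian weights `(ρ(x)/Z)²` of the box sum to `1`;
* **`l2Norm_stageMat_box_sub_le`** — on the box Gaussian `Φ₀ = Σ_x (ρ(x)/Z)|lab₀ x⟩` (labels vanishing
  on the sub-zone, injective final labels), with the query of every point in the `CVP` query format of
  in-range data `c(x)` whose answer table has the answer zone's length:
  `‖stageMat(T_E)Φ₀ − stageMat((U_f)_E)Φ₀‖₂ ≤ 4 √(weightedFail(R, I, ρ, k, y, d, w) + w{¬Admissible_d})`,
  `f` the ideal answer function `CVPOracle.answerFn`, `T` the tidy block of `R.circ k_q`, `w = dataLaw` the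
  law of `c(x)`, `x ∼ (ρ/Z)²` (BBBV Thm. 4.14 + Thm. 3.3, `TidyBlockFn.l2Norm_stage_sum_sub_le`);
* **`law_bound_sampler`** — Regev's Lemma 3.14 measured-law bound for the machine
  `M_F · stageMat(T_E) · (Gaussian stage)`: for every event `A`,
  `|Pr[dec(readS z) ∈ A] − D_{L,1/√2}(A)| ≤ 2(ε₁ + 4√(weightedFail + w{¬Adm}) + ε_F + 8C) + 2η₀ + 9·2⁻ⁿ`;
* **`law_bound_sampler_of_short`** — the same with `w{¬Adm}` replaced by the Gaussian tail `(2C)²`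
  (`CVPOracle.dataLaw_inadmissible_le_of_short`) when every box point with short lattice part has
  admissible data: the `CVP` family then enters ONLY through `√(weightedFail + (2C)²)`, the shape of
  A_q14's bound `C'·√(weightedFail) + ν'`.

What is NOT here (the remaining machine-level work under A_q14): the identification of the sampler's
registers with Regev's data (`QPart.RegHyps`/`FibreHyps` for `kappa Λ answerFn` from
`SamplerClassical.kappa_spec`, and the admissibility of the data of short points from
`SamplerArith.floor_sub_reprPt_eq`), the Grover–Rudolph and Fourier stages as circuits (`ε₁`, `ε_F`), the
uniformity of the composed family and its classical dressing, and the passage from the event-wise bound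
to total variation.

Everything is proved; no definition, no named fact is introduced.

## References

* O. Regev, *On lattices, learning with errors, random linear codes, and cryptography*, J. ACM 56
  (2009), art. 34; author's version arXiv:2401.03703: Lemma 3.3 (proof, p. 15), Lemma 3.14 (proof,
  p. 20), Lemma 2.5 [Regev2009].
* C. H. Bennett, E. Bernstein, G. Brassard, U. Vazirani, *Strengths and weaknesses of quantum
  computing*, SIAM J. Comput. 26 (1997) 1510–1523, Thm. 3.3, Thm. 4.14 [BennettBernsteinBrassardVazirani1997].
-/

noncomputable section

namespace Literature.Computability.Cryptography

namespace Regev2009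

namespace SamplerSubst

open Module Metric Finset _root_.Matrix Literature.Computability.Complexity Literature.Computability.QuantumComplexity
  Literature.Computability.QuantumComplexity.TidyBlockFn Literature.Computability.QuantumComplexity.QState
  Literature.Computability.QuantumComplexity.QFTQubits SamplerClassical CVPOracle
  Literature.Algebra.EuclideanLattices Literature.Algebra.EuclideanLattices.Regev2009
  Literature.Algebra.EuclideanLattices.Regev2009.QPart

open scoped Real InnerProductSpace ENNReal

variable {V : Type*} [NormedAddCommGroup V] [InnerProductSpace ℝ V]

variable {W n : ℕ} {Λ : SamplerClassical.Layout W n} (hΛ : Λ.OK) (hF : Fits Λ)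

omit [InnerProductSpace ℝ V] in
/-- **The substitution error on the box Gaussian is at most `4√(weightedFail + inadmissible mass)`.**
Labels `lab₀ x` vanishing on the sub-zone with injective final labels `kappa Λ f (lab₀ x)`; the query of
every box point is the `CVP` query string of in-range data `c(x)` with answer tables of length `n·b_c`;
`f = answerFn`, `T` the tidy block of `R.circ k_q`. [cite: Regev2009, Lemma 3.14 (proof), Lemma 3.3 (proof)]
[cite: BennettBernsteinBrassardVazirani1997, Thm. 3.3 with Thm. 4.14] -/
theorem l2Norm_stageMat_box_sub_le (R : UniformQCircuitFamily) (Z : SubZone Λ (R.family.ancillas Λ.kq))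
    (I : LatticeInstance) (ρ : ℚ) (k : ℕ) (y : List Bool) (d : ℝ)
    {Box : Finset V} (hne : Box.Nonempty) (lab₀ : V → QReg W) (hlab : ∀ x ∈ Box, ∀ t, lab₀ x (Z.dirt t) = false)
    (hinj : Set.InjOn (kappa Λ (answerFn I ρ k y Λ.kq (n * Λ.bc)) ∘ lab₀) Box)
    (cOf : V → QData I.n) (hx : ∀ x ∈ Box, List.ofFn (qry Λ (kappa Λ (answerFn I ρ k y Λ.kq (n * Λ.bc)) (lab₀ x))) = query I ρ k y (cOf x))
    (hc : ∀ x ∈ Box, InRange (cOf x)) (hℓ : ∀ x ∈ Box, n * Λ.bc ≤ (answerTable I (cOf x)).length) :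
    l2Norm (stageMat hΛ hF (placeGate (subE hΛ Z) (tidyCirc (R.family.circ Λ.kq)).mat) *ᵥ
          embed Box (fun x => (((gaussianFunction 1 x / zBox Box : ℝ)) : ℂ)) lab₀ -
        stageMat hΛ hF (placeGate (subE hΛ Z) (idealFn (answerFn I ρ k y Λ.kq (n * Λ.bc)))) *ᵥ
          embed Box (fun x => (((gaussianFunction 1 x / zBox Box : ℝ)) : ℂ)) lab₀) ≤
      4 * Real.sqrt ((weightedFail R I ρ k y d
            (dataLaw Box (fun x => (gaussianFunction 1 x / zBox Box) ^ 2) (fun _ _ => sq_nonneg _) (sum_boxWeight_eq_one hne) cOf)).toReal +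
          ((dataLaw Box (fun x => (gaussianFunction 1 x / zBox Box) ^ 2) (fun _ _ => sq_nonneg _) (sum_boxWeight_eq_one hne) cOf).toOuterMeasure
            {c | ¬ Admissible I d c}).toReal) := by
  have h := l2Norm_stageMat_sum_sub_le hΛ Z hF Box lab₀ hlab (answerFn I ρ k y Λ.kq (n * Λ.bc)) hinj
    (fun x => (((gaussianFunction 1 x / zBox Box : ℝ)) : ℂ)) (R.family.circ Λ.kq)
  simp_rw [Complex.norm_real, Real.norm_eq_abs, sq_abs] at h
  refine (le_of_eq_of_le (by rfl) h).trans (mul_le_mul_of_nonneg_left (Real.sqrt_le_sqrt ?_) (by norm_num))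
  have hs := sum_mul_errFn_le_weightedFail_add R I ρ k y d Box (fun x => (gaussianFunction 1 x / zBox Box) ^ 2)
    (fun _ _ => sq_nonneg _) (sum_boxWeight_eq_one hne) cOf
    (fun x => qry Λ (kappa Λ (answerFn I ρ k y Λ.kq (n * Λ.bc)) (lab₀ x))) hx hc hℓ
  refine le_trans (le_of_eq ?_) hs
  exact sum_congr rfl fun x _ => mul_comm _ _

variable {m κ : ℕ} {S : Fin m → (Fin κ ↪ Fin W)} {base : V → QReg W} {enc : ZMod (2 ^ κ) → Fin κ → Bool}
  {Box : Finset V} {yOf : V → V} {sOf : V → Fin m → ZMod (2 ^ κ)} {Good : V → Prop} {lab₀ : V → QReg W}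

open Classical in
/-- **Regev 2009, Lemma 3.14 — the measured law of the sampler run with the `CVP` family `R` answering its
two oracle calls.** For the machine `M_F · stageMat(T_E) · (Gaussian stage)` (the Gaussian stage's output
`Ψ_GR` within `ε₁` of the box Gaussian on the labels `lab₀`, the classical stage of `RegevSamplerClassical`
with the placed tidy block of `R.circ k_q` in both oracle slots, `M_F` implementing the `n`-fold QFT up to
`ε_F` on the final labels), Regev's data `(L, (Lⱼ), R = 2^κ)` and the register hypotheses of
`QPart.law_bound_of_basis` for the IDEAL label action `kappa Λ answerFn`, and the query format hypotheses of
`l2Norm_stageMat_box_sub_le`: for every event `A`,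

  `|Pr[dec (readS z) ∈ A] − D_{L,1/√2}(A)| ≤ 2(ε₁ + 4√(weightedFail(R,…,d,w) + w{¬Adm_d}) + ε_F + 8C) + 2η₀ + 9·2⁻ⁿ`.

[cite: Regev2009, Lemma 3.14 (proof), Lemma 3.3 (proof)] [cite: BennettBernsteinBrassardVazirani1997, Thm. 3.3, Thm. 4.14] -/
theorem law_bound_sampler [FiniteDimensional ℝ V] [MeasurableSpace V] [BorelSpace V] [Nontrivial V] [DecidableEq V]
    (R : UniformQCircuitFamily) (Z : SubZone Λ (R.family.ancillas Λ.kq))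
    (I : LatticeInstance) (ρ : ℚ) (k : ℕ) (y : List Bool) (d : ℝ)
    (L : Submodule ℤ V) [DiscreteTopology L] [IsZLattice ℝ L] (bL : Basis (Fin m) ℤ L) [NeZero (2 ^ κ : ℕ)] [DecidablePred Good]
    (hH : FibreHyps (dualOver (2 ^ κ) L bL) (dualOverZBasis (2 ^ κ) L bL) (2 ^ κ) Box yOf sOf Good)
    (hR : RegHyps S base enc Box yOf sOf Good lab₀ (kappa Λ (answerFn I ρ k y Λ.kq (n * Λ.bc)))) (hne : Box.Nonempty)
    (hlab : ∀ x ∈ Box, ∀ t, lab₀ x (Z.dirt t) = false)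
    (cOf : V → QData I.n) (hx : ∀ x ∈ Box, List.ofFn (qry Λ (kappa Λ (answerFn I ρ k y Λ.kq (n * Λ.bc)) (lab₀ x))) = query I ρ k y (cOf x))
    (hc : ∀ x ∈ Box, InRange (cOf x)) (hℓ : ∀ x ∈ Box, n * Λ.bc ≤ (answerTable I (cOf x)).length)
    -- lattice hypotheses
    (hsvΛ : ∀ z ∈ scaledLattice (dualOver (2 ^ κ) L bL) (2 ^ κ), ‖z‖ < 2 * Real.sqrt (finrank ℝ V) → z = 0)
    (hL : ∀ x ∈ L, ‖((2 ^ κ : ℕ) : ℝ) • x‖ < 2 * Real.sqrt (finrank ℝ V) → x = 0)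
    {dec : (Fin m → ZMod (2 ^ κ)) → V}
    (hdec : ∀ t : Fin m → ZMod (2 ^ κ), ∀ x ∈ L,
      ‖∑ j, ((t j).val : ℝ) • ((bL j : L) : V) + ((2 ^ κ : ℕ) : ℝ) • x‖ < Real.sqrt (finrank ℝ V) →
        dec t = ∑ j, ((t j).val : ℝ) • ((bL j : L) : V) + ((2 ^ κ : ℕ) : ℝ) • x)
    {B Y C : ℝ} (hBox : ∀ x ∈ Box, BoxCoversShort (dualOver (2 ^ κ) L bL) Box (yOf x)) (hY : ∀ x ∈ Box, ‖yOf x‖ ≤ Y)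
    (hB : ∀ x ∈ Box, ∀ x' ∈ Box, ‖x - yOf x'‖ ≤ B) (hδ : π * (2 * Real.sqrt (finrank ℝ V) * Y + Y ^ 2) < 1)
    (hC : Real.exp (2 * π * B * Y) * (2⁻¹ : ℝ) ^ finrank ℝ V ≤
      C * ((1 - π * (2 * Real.sqrt (finrank ℝ V) * Y + Y ^ 2)) * (1 - banaConst ^ finrank ℝ V) * (1 - (4⁻¹ : ℝ) ^ finrank ℝ V)))
    (hC2 : C ≤ 1 / 2) (hC0 : 0 ≤ C)
    -- machine hypotheses
    {ΨGR : QReg W → ℂ} (hΨGR : l2Norm ΨGR = 1) {ε₁ : ℝ}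
    (hε₁ : l2Norm (ΨGR - embed Box (fun x => (((gaussianFunction 1 x / zBox Box : ℝ)) : ℂ)) lab₀) ≤ ε₁)
    {MF : Matrix (QReg W) (QReg W) ℂ} (hMFU : MF ∈ Matrix.unitaryGroup (QReg W) ℂ) {PF : Set (QReg W)} {εF : ℝ}
    (hMF : ImplOn PF MF (multiQFT S) εF) (hPF : ∀ x ∈ Box, kappa Λ (answerFn I ρ k y Λ.kq (n * Λ.bc)) (lab₀ x) ∈ PF)
    (A : Set V) :
    |∑ z ∈ univ.filter (fun z => dec (readS S z) ∈ A),
        ‖(MF *ᵥ (stageMat hΛ hF (placeGate (subE hΛ Z) (tidyCirc (R.family.circ Λ.kq)).mat) *ᵥ ΨGR)) z‖ ^ 2 -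
        ((discreteGaussian L (Real.sqrt 2)⁻¹ 0).toOuterMeasure {x : L | (x : V) ∈ A}).toReal| ≤
      2 * (ε₁ + 4 * Real.sqrt ((weightedFail R I ρ k y d
              (dataLaw Box (fun x => (gaussianFunction 1 x / zBox Box) ^ 2) (fun _ _ => sq_nonneg _) (sum_boxWeight_eq_one hne) cOf)).toReal +
            ((dataLaw Box (fun x => (gaussianFunction 1 x / zBox Box) ^ 2) (fun _ _ => sq_nonneg _) (sum_boxWeight_eq_one hne) cOf).toOuterMeasure
              {c | ¬ Admissible I d c}).toReal) + εF + 8 * C) +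
        2 * (Real.sqrt (2 * (π * (2 * Real.sqrt (finrank ℝ V) * Y + Y ^ 2) + banaConst ^ finrank ℝ V + 4⁻¹ ^ finrank ℝ V)) +
          2 * (2⁻¹ : ℝ) ^ finrank ℝ V) + 9 * (2⁻¹ : ℝ) ^ finrank ℝ V := by
  set fn := answerFn I ρ k y Λ.kq (n * Λ.bc) with hfn
  have hO : IsBasisMap (placeGate (subE hΛ Z) (idealFn (d := R.family.ancillas Λ.kq) fn)) (oracleAct Λ fn) := by
    rw [← kappaO_subE hΛ Z fn]
    exact isBasisMap_kappaO _ _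
  have hMcl := isBasisMap_stageMat hΛ hF hO
  have hMclU := stageMat_mem_unitaryGroup hΛ hF (placeGate_idealFn_mem_unitaryGroup (d := R.family.ancillas Λ.kq) fn (subE hΛ Z))
  have hMreU := stageMat_mem_unitaryGroup hΛ hF (placeGate_tidyCirc_mem_unitaryGroup (ℓ := n * Λ.bc) (R.family.circ Λ.kq) (subE hΛ Z))
  have hεS := l2Norm_stageMat_box_sub_le hΛ hF R Z I ρ k y d hne lab₀ hlab hR.lab_inj cOf hx hc hℓ
  exact law_bound_of_basis_near L bL hH hR hne hsvΛ hL hdec hBox hY hB hδ hC hC2 hC0 hΨGR hε₁ hMcl hMclU hMreU hεS hMFU hMF hPF A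

open Classical in
/-- **Regev 2009, Lemma 3.14 with the `CVP` family — the inadmissible mass discharged.** As
`law_bound_sampler`, when every box point with short lattice part (`‖x − y(x)‖ < √n`) has admissible data
(`Admissible I d (c x)`): the `CVP` family `R` enters only through `4√(weightedFail(R,…,d,w) + (2C)²)`.
[cite: Regev2009, Lemma 3.14 (proof), Lemma 3.3 (proof), Claim 3.13] [cite: BennettBernsteinBrassardVazirani1997, Thm. 3.3, Thm. 4.14] -/
theorem law_bound_sampler_of_short [FiniteDimensional ℝ V] [MeasurableSpace V] [BorelSpace V] [Nontrivial V] [DecidableEq V]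
    (R : UniformQCircuitFamily) (Z : SubZone Λ (R.family.ancillas Λ.kq))
    (I : LatticeInstance) (ρ : ℚ) (k : ℕ) (y : List Bool) (d : ℝ)
    (L : Submodule ℤ V) [DiscreteTopology L] [IsZLattice ℝ L] (bL : Basis (Fin m) ℤ L) [NeZero (2 ^ κ : ℕ)] [DecidablePred Good]
    (hH : FibreHyps (dualOver (2 ^ κ) L bL) (dualOverZBasis (2 ^ κ) L bL) (2 ^ κ) Box yOf sOf Good)
    (hR : RegHyps S base enc Box yOf sOf Good lab₀ (kappa Λ (answerFn I ρ k y Λ.kq (n * Λ.bc)))) (hne : Box.Nonempty)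
    (hlab : ∀ x ∈ Box, ∀ t, lab₀ x (Z.dirt t) = false)
    (cOf : V → QData I.n) (hx : ∀ x ∈ Box, List.ofFn (qry Λ (kappa Λ (answerFn I ρ k y Λ.kq (n * Λ.bc)) (lab₀ x))) = query I ρ k y (cOf x))
    (hc : ∀ x ∈ Box, InRange (cOf x)) (hℓ : ∀ x ∈ Box, n * Λ.bc ≤ (answerTable I (cOf x)).length)
    (hAdm : ∀ x ∈ Box, ‖x - yOf x‖ < Real.sqrt (finrank ℝ V) → Admissible I d (cOf x))
    -- lattice hypotheses
    (hsvΛ : ∀ z ∈ scaledLattice (dualOver (2 ^ κ) L bL) (2 ^ κ), ‖z‖ < 2 * Real.sqrt (finrank ℝ V) → z = 0)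
    (hL : ∀ x ∈ L, ‖((2 ^ κ : ℕ) : ℝ) • x‖ < 2 * Real.sqrt (finrank ℝ V) → x = 0)
    {dec : (Fin m → ZMod (2 ^ κ)) → V}
    (hdec : ∀ t : Fin m → ZMod (2 ^ κ), ∀ x ∈ L,
      ‖∑ j, ((t j).val : ℝ) • ((bL j : L) : V) + ((2 ^ κ : ℕ) : ℝ) • x‖ < Real.sqrt (finrank ℝ V) →
        dec t = ∑ j, ((t j).val : ℝ) • ((bL j : L) : V) + ((2 ^ κ : ℕ) : ℝ) • x)
    {B Y C : ℝ} (hBox : ∀ x ∈ Box, BoxCoversShort (dualOver (2 ^ κ) L bL) Box (yOf x)) (hY : ∀ x ∈ Box, ‖yOf x‖ ≤ Y)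
    (hB : ∀ x ∈ Box, ∀ x' ∈ Box, ‖x - yOf x'‖ ≤ B) (hδ : π * (2 * Real.sqrt (finrank ℝ V) * Y + Y ^ 2) < 1)
    (hC : Real.exp (2 * π * B * Y) * (2⁻¹ : ℝ) ^ finrank ℝ V ≤
      C * ((1 - π * (2 * Real.sqrt (finrank ℝ V) * Y + Y ^ 2)) * (1 - banaConst ^ finrank ℝ V) * (1 - (4⁻¹ : ℝ) ^ finrank ℝ V)))
    (hC2 : C ≤ 1 / 2) (hC0 : 0 ≤ C)
    -- machine hypotheses
    {ΨGR : QReg W → ℂ} (hΨGR : l2Norm ΨGR = 1) {ε₁ : ℝ}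
    (hε₁ : l2Norm (ΨGR - embed Box (fun x => (((gaussianFunction 1 x / zBox Box : ℝ)) : ℂ)) lab₀) ≤ ε₁)
    {MF : Matrix (QReg W) (QReg W) ℂ} (hMFU : MF ∈ Matrix.unitaryGroup (QReg W) ℂ) {PF : Set (QReg W)} {εF : ℝ}
    (hMF : ImplOn PF MF (multiQFT S) εF) (hPF : ∀ x ∈ Box, kappa Λ (answerFn I ρ k y Λ.kq (n * Λ.bc)) (lab₀ x) ∈ PF)
    (A : Set V) :
    |∑ z ∈ univ.filter (fun z => dec (readS S z) ∈ A),
        ‖(MF *ᵥ (stageMat hΛ hF (placeGate (subE hΛ Z) (tidyCirc (R.family.circ Λ.kq)).mat) *ᵥ ΨGR)) z‖ ^ 2 -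
        ((discreteGaussian L (Real.sqrt 2)⁻¹ 0).toOuterMeasure {x : L | (x : V) ∈ A}).toReal| ≤
      2 * (ε₁ + 4 * Real.sqrt ((weightedFail R I ρ k y d
              (dataLaw Box (fun x => (gaussianFunction 1 x / zBox Box) ^ 2) (fun _ _ => sq_nonneg _) (sum_boxWeight_eq_one hne) cOf)).toReal +
            (2 * C) ^ 2) + εF + 8 * C) +
        2 * (Real.sqrt (2 * (π * (2 * Real.sqrt (finrank ℝ V) * Y + Y ^ 2) + banaConst ^ finrank ℝ V + 4⁻¹ ^ finrank ℝ V)) +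
          2 * (2⁻¹ : ℝ) ^ finrank ℝ V) + 9 * (2⁻¹ : ℝ) ^ finrank ℝ V := by
  have h := law_bound_sampler hΛ hF R Z I ρ k y d L bL hH hR hne hlab cOf hx hc hℓ hsvΛ hL hdec hBox hY hB hδ hC hC2 hC0
    hΨGR hε₁ hMFU hMF hPF A
  have ht := dataLaw_inadmissible_le_of_short hH hR hne hsvΛ hBox hY hB hδ hC hC2 hC0 I d cOf hAdm
  refine h.trans ?_
  gcongr

end SamplerSubst

end Regev2009

end Literature.Computability.Cryptography

end
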